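import Literature.RingTheory.PowerSeries.LaurentSeriesDerivation
import Mathlib.RingTheory.Derivation.Basic
import HarnessLib

/-!
# The Laurent series field as a differential field: the derivation `d/dX` and its constants

`Literature/RingTheory/PowerSeries/LaurentSeriesConstants.lean` — everything PROVED, no
definition. Mathlib's `LaurentSeries.derivative R : R⸨X⸩ →ₗ[R] R⸨X⸩` together with the Leibniz
rule of `LaurentSeriesDerivation.lean` is packaged as (the existence of) a `Derivation`
(`exists_derivation_eq_derivative`), and over a ring of characteristic zero without zero
divisors its constants are computed: `f′ = 0 ↔ f = C f₀` (`derivative_eq_zero_iff`). This is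
the differential field `(ℂ⸨X⸩, d/dX)` with field of constants `ℂ` in which Ax's theorem
(`Literature.NumberTheory.Transcendental.ax_schanuel`) is applied to Laurent expansions of germs
of meromorphic functions. [folklore]
-/

noncomputable section

open HahnSeries LaurentSeries PowerSeries

namespace Literature.RingTheory.PowerSeries

variable {R : Type*} [CommRing R]

/-- The derivative of `1` vanishes. [folklore] -/
theorem derivative_one : LaurentSeries.derivative R (1 : R⸨X⸩) = 0 := by
  ext n
  rw [laurent_coeff_derivative, HahnSeries.coeff_one, HahnSeries.coeff_zero]
  by_cases hn : n + 1 = 0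
  · have : n = -1 := by omega
    subst this
    simp
  · rw [if_neg hn, smul_zero]

/-- The derivative of a constant vanishes. [folklore] -/
theorem derivative_C (c : R) : LaurentSeries.derivative R (HahnSeries.C c : R⸨X⸩) = 0 := by
  ext n
  rw [laurent_coeff_derivative, HahnSeries.C_apply, HahnSeries.coeff_single, HahnSeries.coeff_zero]
  by_cases hn : n + 1 = 0
  · have : n = -1 := by omega
    subst this
    simp
  · rw [if_neg hn, smul_zero]

/-- The algebra map `R → R⸨X⸩` is `HahnSeries.C`. [folklore] -/
theorem algebraMap_laurentSeries_apply (c : R) : algebraMap R R⸨X⸩ c = HahnSeries.C c := by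
  change HahnSeries.ofPowerSeries ℤ R (algebraMap R (PowerSeries R) c) = HahnSeries.C c
  rw [show algebraMap R (PowerSeries R) c = PowerSeries.C c from rfl, HahnSeries.ofPowerSeries_C]

/-- **`d/dX` is an `R`-linear derivation of `R⸨X⸩`**: existence of a `Derivation R R⸨X⸩ R⸨X⸩`
whose underlying map is Mathlib's `LaurentSeries.derivative`. [folklore] -/
theorem exists_derivation_eq_derivative :
    ∃ D : Derivation R R⸨X⸩ R⸨X⸩, ∀ f, D f = LaurentSeries.derivative R f := by
  let D : Derivation R R⸨X⸩ R⸨X⸩ :=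
    { toFun := fun f => LaurentSeries.derivative R f
      map_add' := fun f g => map_add (LaurentSeries.derivative R) f g
      map_smul' := fun c f => by
        simp only [RingHom.id_apply]
        rw [Algebra.smul_def, algebraMap_laurentSeries_apply, derivative_mul, derivative_C,
          zero_mul, zero_add, HahnSeries.C_mul_eq_smul]
      map_one_eq_zero' := by
        change LaurentSeries.derivative R (1 : R⸨X⸩) = 0
        exact derivative_one
      leibniz' := by
        intro a b
        change LaurentSeries.derivative R (a * b) =
          a • LaurentSeries.derivative R b + b • LaurentSeries.derivative R a
        rw [derivative_mul, smul_eq_mul, smul_eq_mul]; ring }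
  exact ⟨D, fun f => rfl⟩

/-- **Constants of `d/dX`.** Over a ring of characteristic zero without zero divisors,
`f′ = 0` iff `f` is the constant `C f₀`. [folklore] -/
theorem derivative_eq_zero_iff [IsDomain R] [CharZero R] (f : R⸨X⸩) :
    LaurentSeries.derivative R f = 0 ↔ f = HahnSeries.C (f.coeff 0) := by
  constructor
  · intro h
    ext n
    rw [HahnSeries.C_apply, HahnSeries.coeff_single]
    by_cases hn : n = 0
    · subst hn; simp
    · rw [if_neg hn]
      have hc := congrArg (fun g : R⸨X⸩ => g.coeff (n - 1)) h
      simp only [laurent_coeff_derivative, sub_add_cancel, HahnSeries.coeff_zero, zsmul_eq_mul,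
        mul_eq_zero] at hc
      rcases hc with hc | hc
      · exact absurd hc (by exact_mod_cast hn)
      · exact hc
  · intro h
    rw [h, derivative_C]

/-- Constants of `d/dX`, range form: `f′ = 0 ↔ f ∈ range C`. [folklore] -/
theorem derivative_eq_zero_iff_mem_range [IsDomain R] [CharZero R] (f : R⸨X⸩) :
    LaurentSeries.derivative R f = 0 ↔ f ∈ Set.range (HahnSeries.C : R →+* R⸨X⸩) := by
  rw [derivative_eq_zero_iff]
  constructor
  · intro h; exact ⟨f.coeff 0, h.symm⟩
  · rintro ⟨c, rfl⟩
    simp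

/-- Constants of `d/dX` are the scalars: `f′ = 0 ↔ f ∈ range (algebraMap R R⸨X⸩)` (the
hypothesis `hC` of `Literature.NumberTheory.Transcendental.Ax1971.add_rank_le_trdeg_of_field`).
[folklore] -/
theorem derivative_eq_zero_iff_mem_range_algebraMap [IsDomain R] [CharZero R] (f : R⸨X⸩) :
    LaurentSeries.derivative R f = 0 ↔ f ∈ Set.range (algebraMap R R⸨X⸩) := by
  rw [derivative_eq_zero_iff_mem_range]
  constructor
  · rintro ⟨c, rfl⟩; exact ⟨c, algebraMap_laurentSeries_apply c⟩
  · rintro ⟨c, rfl⟩; exact ⟨c, (algebraMap_laurentSeries_apply c).symm⟩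

end Literature.RingTheory.PowerSeries

end
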